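import Mathlib
import Summits.CriticalPhenomena.Ising3DConformalLimit.Theorems.PrecisionLaplacianInverseMFerromagnetOneSum
import Summits.CriticalPhenomena.Ising3DConformalLimit.Theorems.PrecisionLaplacianInverseMFerromagnetTwoSumPrecision
import Summits.CriticalPhenomena.Ising3DConformalLimit.Theorems.PrecisionLaplacianInverseMFerromagnetTwoSepMarkov
import HarnessLib

/-!
# Crux `PrecisionLaplacian.InverseMFerromagnet` (stmt-CriticalPhenomena-4798), line `Sketch` —
# stubs `helper_precision_zero_of_oneSep` / `helper_precision_zero_of_twoSep`
# (exact zeros of the precision matrix across ≤2-separators)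

THEOREM-ONLY file (no definitions).  Let `Σ = (⟨σ_pσ_q⟩)_{p,q}` be the spin second-moment matrix
of the zero-field pair ferromagnet `gksExpect univ K C` on `Fin n` (`K ≥ 0`, `|C i| = 2`).

* `helper_precision_zero_of_oneSep` (Z1): if every bond lies inside `A` or inside
  `B = insert v Aᶜ` (`v ∈ A`), then `(Σ⁻¹)_xy = 0` for `x ∈ A ∖ {v}`, `y ∉ A`.  This is the
  `(x, y)` entry of the 1-sum precision formula `Σ⁻¹ = [Σ_AA⁻¹]⁰ + [Σ_BB⁻¹]⁰ − e_ve_vᵀ`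
  (`helper_oneSum_precision`): the `A`-block vanishes because `y ∉ A`, the `B`-block because
  `x ∉ B`, and the unit entry because `x ≠ v`.
* `helper_precision_zero_of_twoSep` (Z2): if every bond lies inside `A` or inside
  `B = insert c₁ (insert c₂ Aᶜ)` (`c₁ ≠ c₂` in `A`), then `(Σ⁻¹)_xy = 0` for
  `x ∈ A ∖ {c₁, c₂}`, `y ∉ A`.  The Markov factorisation across the separator
  (`helper_twoSep_markov`) is exactly the hypothesis of the 2-sum precision formula
  `Σ⁻¹ = [Σ_AA⁻¹]⁰ + [Σ_BB⁻¹]⁰ − [Σ_SS⁻¹]⁰`, `S = {c₁, c₂}` (`helper_twoSum_precision`), and at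
  `(x, y)` all three blocks vanish (`y ∉ A`, `x ∉ B`, `x ∉ S`).
-/

namespace Summit.CriticalPhenomena.Ising3DConformalLimit.Cruxes.InverseMFerromagnet.PartialCovarianceLadder

open Literature.Probability.LatticeModels Finset Matrix

noncomputable section

/-- Registered stub `helper_precision_zero_of_oneSep` (**Z1 · exact zero across a 1-separator**).
If every bond lies inside `A` or inside `insert v Aᶜ` (`v ∈ A` a cut vertex, or the sides
disconnected), then `(Σ⁻¹)_xy = 0` for `x ∈ A ∖ {v}`, `y ∉ A`: the `(x, y)` entry of
`helper_oneSum_precision`, all three of whose terms vanish there. [folklore] -/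
theorem helper_precision_zero_of_oneSep :
    ∀ (n m : ℕ) (K : Fin m → ℝ) (C : Fin m → Finset (Fin n)), (∀ i, 0 ≤ K i) → (∀ i, (C i).card = 2) →
      ∀ (v : Fin n) (A : Finset (Fin n)), v ∈ A → (∀ i, C i ⊆ A ∨ C i ⊆ insert v Aᶜ) →
        ∀ x y : Fin n, x ∈ A → x ≠ v → y ∉ A →
          (Matrix.of fun p q : Fin n => gksExpect Finset.univ K C (fun ω => spinAt p ω * spinAt q ω))⁻¹ x y = 0 := by
  intro n m K C hK hC v A hv hAB x y hx hxv hy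
  have hxB : x ∉ insert v Aᶜ := fun h' => by
    rcases Finset.mem_insert.1 h' with h' | h'
    · exact hxv h'
    · exact (Finset.mem_compl.1 h') hx
  rw [helper_oneSum_precision n m K C hK hC v A hv hAB _ rfl x y,
    dif_neg (show ¬(x ∈ A ∧ y ∈ A) from fun h' => hy h'.2),
    dif_neg (show ¬(x ∈ insert v Aᶜ ∧ y ∈ insert v Aᶜ) from fun h' => hxB h'.1),
    if_neg (show ¬(x = v ∧ y = v) from fun h' => hxv h'.1)]
  norm_num

/-- Registered stub `helper_precision_zero_of_twoSep` (**Z2 · exact zero across a 2-separator**).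
If every bond lies inside `A` or inside `insert c₁ (insert c₂ Aᶜ)` (`c₁ ≠ c₂` in `A`), then
`(Σ⁻¹)_xy = 0` for `x ∈ A ∖ {c₁, c₂}`, `y ∉ A`: `helper_twoSep_markov` supplies the Markov
factorisation hypothesis of `helper_twoSum_precision`, and at `(x, y)` the `A`-, `B`- and
`S`-blocks of the 2-sum precision formula all vanish. [folklore] -/
theorem helper_precision_zero_of_twoSep :
    ∀ (n m : ℕ) (K : Fin m → ℝ) (C : Fin m → Finset (Fin n)), (∀ i, 0 ≤ K i) → (∀ i, (C i).card = 2) →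
      ∀ (c₁ c₂ : Fin n) (A : Finset (Fin n)), c₁ ≠ c₂ → c₁ ∈ A → c₂ ∈ A →
        (∀ i, C i ⊆ A ∨ C i ⊆ insert c₁ (insert c₂ Aᶜ)) →
        ∀ x y : Fin n, x ∈ A → x ≠ c₁ → x ≠ c₂ → y ∉ A →
          (Matrix.of fun p q : Fin n => gksExpect Finset.univ K C (fun ω => spinAt p ω * spinAt q ω))⁻¹ x y = 0 := by
  intro n m K C hK hC c₁ c₂ A hc hc₁ hc₂ hAB x y hx hx₁ hx₂ hy
  have hMarkov := helper_twoSep_markov n m K C hK hC c₁ c₂ A hc hc₁ hc₂ hAB _ rfl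
  have hxB : x ∉ insert c₁ (insert c₂ Aᶜ) := fun h' => by
    rcases Finset.mem_insert.1 h' with h' | h'
    · exact hx₁ h'
    rcases Finset.mem_insert.1 h' with h' | h'
    · exact hx₂ h'
    · exact (Finset.mem_compl.1 h') hx
  have hxS : x ∉ ({c₁, c₂} : Finset (Fin n)) := fun h' => by
    rcases Finset.mem_insert.1 h' with h' | h'
    · exact hx₁ h'
    · exact hx₂ (Finset.mem_singleton.1 h')
  rw [helper_twoSum_precision n m K C hK hC c₁ c₂ A hc hc₁ hc₂ hAB _ rfl hMarkov x y,
    dif_neg (show ¬(x ∈ A ∧ y ∈ A) from fun h' => hy h'.2),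
    dif_neg (show ¬(x ∈ insert c₁ (insert c₂ Aᶜ) ∧ y ∈ insert c₁ (insert c₂ Aᶜ)) from
      fun h' => hxB h'.1),
    dif_neg (show ¬(x ∈ ({c₁, c₂} : Finset (Fin n)) ∧ y ∈ ({c₁, c₂} : Finset (Fin n))) from
      fun h' => hxS h'.1)]
  norm_num

end

end Summit.CriticalPhenomena.Ising3DConformalLimit.Cruxes.InverseMFerromagnet.PartialCovarianceLadder
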